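import Summits.CriticalPhenomena.PercolationContinuityZ3.Theorems.PercNearOneGluingNoHeavyQuantFarTreeRootReduction
import Summits.CriticalPhenomena.PercolationContinuityZ3.Theorems.PercNearOneGluingNoHeavyQuantDIBStarBridge
import HarnessLib

/-!
# QUANT lane R8, FAR on general trees — the CONDITIONAL root row in gate coordinates:
# `DEC-certificate ∧ DIB ⟹ Quant.FarTreeRow instance-wise` (ARCH-TREES-G49 §8 (F2))

builds on p205010 (kernel theorem, internal audit signed; external expert review pending)

Support file (`--supports stmt-CriticalPhenomena-4575`), QUANT lane typer seat prim-quant-stmt (gen 17), rung R8 of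
`run/shared/lean/prim/quant/LADDER.md`; completes the gate-coordinate end of T-RED (README V185/V189) begun in
`…QuantFarTreeRootReduction.lean` (identification `real_heavy_eq_rtail`, unconditional `farTree_of_heavyDec`).  Theorems only,
no sorries, standard axioms.

* `Quant.RootDecGate.farTree_of_decCert` — in the setting of `…QuantFarTreeRootReduction` (independent gates `q`, relays `A`,
  ancestor sets `P`, a labelling `comp` constant along ancestry), assume the discounted-independent-blob row
  `Quant.IndepBlob.DIBWith (1 − t) ψ` (`…QuantDIBStar`: Conjecture DIB\* = `DIBStar`, or census-2's weaker `DIBPsi`, via `.dibWith`),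
  `0 ≤ t`, every structure law decomposed into two-point components with genuine gates in `[0,1]`, and every genuine term certified
  by β (sure mass `≥ j+1`), α (a heavy giant) or γ (effective discounted credit `> 2(j − s)`) exactly as in
  `Quant.RootDec.rtail_ge_of_decCert`.  Then `P(N ≤ j) ≤ t` — `Quant.FarTreeRow`'s conclusion for that instance.
  Which decompositions/certificates EXIST (Conjectures LIGHT-DEC / TERM / Φ-CLOSURE of ARCH §4/§6.3/§8) is not asserted.
* `Quant.RootDecGate.farTree_of_decCert_of_le_half` — the same with the DIB hypothesis DISCHARGED when the floor `1 − t ≤ 1/2`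
  (`Quant.IndepBlob.DIBStar.of_le_half`, `…QuantDIBStarBridge`, from lead g15's `dibStar_of_le_half`): unconditional.

[this work]; architecture prim-quant-census-2 g49 ARCH-TREES-G49 (this lane); the gluing rows served
[cite: KozmaNitzan2024, Conjecture 3 (p. 15)].
-/

noncomputable section

namespace Summit.CriticalPhenomena.PercolationContinuityZ3.Theorems

namespace Quant

namespace RootDecGate

open Finset MeasureTheory
open Literature.Probability.LatticeModels
open Literature.Probability.Percolation
open scoped Classical

variable {E : Type*} [Fintype E] {κ : Type} [Fintype κ] [DecidableEq κ]

/-- the two-point law `{lo, hi; g}` (as in `…QuantRootReduction`) -/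
local notation3 "TP[" lo ", " hi ", " g ", " h "]" =>
  (g : ℝ) * (if (h : ℕ) = (hi : ℕ) then (1 : ℝ) else 0) + (1 - (g : ℝ)) * (if (h : ℕ) = (lo : ℕ) then (1 : ℝ) else 0)

/-- the relays of structure `k` reached in `ω` (as in `…QuantFarTreeRootReduction`) -/
local notation3 "Nk[" A ", " P ", " comp ", " k ", " ω "]" =>
  (((A : Finset E).filter fun a => (comp : E → κ) a = k).filter fun a => (((P : E → Finset E) a : Finset E) : Set E) ⊆ (ω : Set E)).card

/-- **`Quant.FarTreeRow` instance-wise from a DEC-certificate and the DIB row (conditional).**  In the setting above, assume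
`DIBWith (1 − t) ψ` (`…QuantDIBStar`: Conjecture DIB\* or DIB-ψ at floor `1 − t`), `0 ≤ t`, the structure laws decomposed into
two-point components with genuine gates in `[0,1]`, and every genuine term certified by β (sure mass `≥ j+1`), α (a heavy
giant) or γ (effective discounted credit `> 2(j − s)`), as in `Quant.RootDec.rtail_ge_of_decCert`.  Then `P(N ≤ j) ≤ t`. [this work] -/
theorem farTree_of_decCert {ρ : Type*} [Fintype ρ] [DecidableEq ρ] {ψ : ℝ → ℝ} (q : E → unitInterval) (A : Finset E)
    (P : E → Finset E) (comp : E → κ) (hP : ∀ a ∈ A, ∀ y ∈ P a, comp y = comp a) (j : ℕ) (t : ℝ) (ht : 0 ≤ t)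
    (hD : IndepBlob.DIBWith (1 - t) ψ)
    (lam : κ → ρ → ℝ) (lo hi : κ → ρ → ℕ) (g : κ → ρ → ℝ)
    (hlam0 : ∀ k r, 0 ≤ lam k r) (hlam1 : ∀ k, ∑ r, lam k r = 1)
    (hμ : ∀ k h, (prodBernoulli q).real {ω : Set E | Nk[A, P, comp, k, ω] = h} =
      ∑ r, lam k r * TP[lo k r, hi k r, g k r, h])
    (hlohi : ∀ k r, lo k r ≤ hi k r) (hhi : ∀ k r, hi k r ≤ (A.filter fun a => comp a = k).card)
    (hg : ∀ k r, 0 < lam k r → 0 ≤ g k r ∧ g k r ≤ 1)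
    (hcert : ∀ σ : κ → ρ, (∀ k, 0 < lam k (σ k)) →
      (j + 1 ≤ ∑ k, lo k (σ k)) ∨
      (∃ k, 1 - t ≤ g k (σ k) ∧ j + 1 ≤ (∑ k', lo k' (σ k')) + (hi k (σ k) - lo k (σ k))) ∨
      ((2 * j : ℝ) < 2 * ((∑ k, lo k (σ k) : ℕ) : ℝ) + ∑ k, (if 1 - t ≤ g k (σ k)
        then ((hi k (σ k) - lo k (σ k) : ℕ) : ℝ) * g k (σ k)
        else ((min (hi k (σ k) - lo k (σ k)) (j - ∑ k', lo k' (σ k')) : ℕ) : ℝ) * max (ψ (g k (σ k))) 0))) :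
    (prodBernoulli q).real {ω : Set E | (A.filter fun a => ((P a : Finset E) : Set E) ⊆ ω).card ≤ j} ≤ t := by
  have key := RootDec.rtail_ge_of_decCert hD (fun k => (A.filter fun a => comp a = k).card)
    (fun k h => (prodBernoulli q).real {ω : Set E | Nk[A, P, comp, k, ω] = h}) lam lo hi g j (by linarith)
    hlam0 hlam1 hμ hlohi hhi hg hcert
  rw [← real_heavy_eq_rtail q A P comp hP j] at key
  rw [real_light_eq_one_sub]
  linarith


/-- **The conditional row made unconditional at floors `1 − t ≤ 1/2`** (`DIBStar.of_le_half`): a DEC-certificate (β/α/γ with the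
DIB\* credit `κ_{1−t}`) for every genuine term ⟹ `P(N ≤ j) ≤ t`, for every `t ≥ 1/2`. [this work] -/
theorem farTree_of_decCert_of_le_half {ρ : Type*} [Fintype ρ] [DecidableEq ρ] (q : E → unitInterval) (A : Finset E)
    (P : E → Finset E) (comp : E → κ) (hP : ∀ a ∈ A, ∀ y ∈ P a, comp y = comp a) (j : ℕ) (t : ℝ) (ht : 1 / 2 ≤ t)
    (lam : κ → ρ → ℝ) (lo hi : κ → ρ → ℕ) (g : κ → ρ → ℝ)
    (hlam0 : ∀ k r, 0 ≤ lam k r) (hlam1 : ∀ k, ∑ r, lam k r = 1)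
    (hμ : ∀ k h, (prodBernoulli q).real {ω : Set E | Nk[A, P, comp, k, ω] = h} =
      ∑ r, lam k r * TP[lo k r, hi k r, g k r, h])
    (hlohi : ∀ k r, lo k r ≤ hi k r) (hhi : ∀ k r, hi k r ≤ (A.filter fun a => comp a = k).card)
    (hg : ∀ k r, 0 < lam k r → 0 ≤ g k r ∧ g k r ≤ 1)
    (hcert : ∀ σ : κ → ρ, (∀ k, 0 < lam k (σ k)) →
      (j + 1 ≤ ∑ k, lo k (σ k)) ∨
      (∃ k, 1 - t ≤ g k (σ k) ∧ j + 1 ≤ (∑ k', lo k' (σ k')) + (hi k (σ k) - lo k (σ k))) ∨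
      ((2 * j : ℝ) < 2 * ((∑ k, lo k (σ k) : ℕ) : ℝ) + ∑ k, (if 1 - t ≤ g k (σ k)
        then ((hi k (σ k) - lo k (σ k) : ℕ) : ℝ) * g k (σ k)
        else ((min (hi k (σ k) - lo k (σ k)) (j - ∑ k', lo k' (σ k')) : ℕ) : ℝ) *
          max ((g k (σ k) - (1 - t) ^ 2) / (1 - (1 - t))) 0))) :
    (prodBernoulli q).real {ω : Set E | (A.filter fun a => ((P a : Finset E) : Set E) ⊆ ω).card ≤ j} ≤ t :=
  farTree_of_decCert q A P comp hP j t (by linarith) (IndepBlob.DIBStar.of_le_half (by linarith)) lam lo hi g hlam0 hlam1 hμ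
    hlohi hhi hg hcert

end RootDecGate

end Quant

end Summit.CriticalPhenomena.PercolationContinuityZ3.Theorems
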